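import Mathlib
import Literature.MathematicalPhysics.MHD.SolovevFluxSurfaceForceBalance
import Literature.MathematicalPhysics.MHD.SolovevFluxSurfaceGGJMonotone
import HarnessLib

/-!
# The Glasser–Greene–Johnson pieces `E, F, H` and the resistive-interchange index `D_R` of a surface in an
# ARBITRARY label (relabelled to the volume/Hamada label), and their inputs on the Lee–Cerfon / PCF Solov'ev
# family: the two extra averages `⟨B²⟩, ⟨σB²⟩` on the printed loop as explicit one-dimensional integrals (proved)

Eleventh file of the `lcLoop` series (gridfusion-model-5). Context: gridfusion-lit-3's `MercierFluxForm.lean`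
types GGJ's `E, F, H` (Zheng 2015 (2.64)) and the resistive index `D_R = F + E + H²` (Zheng (3.42)) AS
PRINTED, i.e. for `SurfaceData` in a HAMADA label (`V′ = 1`, `V″ = 0`), with the two further
label-independent averages `sB2 = ⟨σB²⟩`, `B2 = ⟨B²⟩` as inputs [Zheng2015 §2.3 (2.64), §3.2 (3.42)].
The per-surface GGJ/Mercier record of the analytic family, `lcGGJData κ F_B R₀ q₀ a g r`
(`SolovevFluxSurfaceGGJData.lean`), lives in the poloidal-flux label `ψ := Ψ` (`Ψ′ = 2π`, `V′ ≠ 1`).  This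
file supplies the bridge:

* §1 (generic, any `SurfaceData` `d` with `V′ ≠ 0`): the printed pieces of the VOLUME-RELABELLED data
  `d.relabel d.V′ d.V″` (Hamada by `relabel_volume`) in terms of the original fields —
  `H = V′⟨B²/G⟩/Λ · (⟨σB²/G⟩/⟨B²/G⟩ − ⟨σB²⟩/⟨B²⟩)`, `F = V′²⟨B²/G⟩/Λ² · (⟨σ²B²/G⟩ − ⟨σB²/G⟩²/⟨B²/G⟩ + p′²⟨1/B²⟩)`,
  and, for FORCE-BALANCED data, `E = V′⟨B²/G⟩/Λ² · (K′Φ″ − I′Ψ″ − p′V″ + Λ⟨σB²⟩/⟨B²⟩)` (the `h″ = V″` terms of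
  the relabelled second derivatives pair off against `p′V′ + I′Ψ′ − K′Φ′ = 0`); hence `D_R` explicitly, and the
  consistency `D_I(volume label) = mercierD − 1/4` with lit-3's label-invariant index (`mercierD_relabel`);
* §2 (the family): `⟨σB²⟩ = C_s g` (a surface constant, `sigmaBsq_lcLoop`) and
  `⟨B²⟩ = (g²∫w/u + ∫G·w/u) ÷ ∫w` on `lcLoop R₀ κ r` (`u = R²`, `G = lcGradSq`, `w = lcAvgWeight`), the ONE new
  one-dimensional integral being `∫₀^{2π} G·w/u dt = V′⟨B_p²⟩/(2π)`; positivity of `⟨B²⟩` and of `⟨B²/G⟩`;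
* §3 the index of the surface, `lcResistiveIndex κ F_B R₀ q₀ a g r := D_R` of the volume-relabelled
  `lcGGJData` with these two averages, its closed form through the `lcGGJData_…` field lemmas (`K′ = 0`,
  `Ψ″ = 0`, `p′ = −C_s`, `Λ = −2πΦ″`), and the kernel consequence of a certified sign:
  `lcResistiveIndex … < 0 → (lcGGJData …).MercierCriterion` (lit-3's `mercierCriterion_of_ggjDR_neg` + the
  family's force balance `lcGGJData_isForceBalanced`), for surfaces with shear (`Φ″ ≠ 0`).

So a certificate of the SIGN of `D_R` on a named PCF surface needs exactly the integrals already enclosed for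
the Mercier-profile certificates (gridfusion-sos-6) plus `∫ G·w/u`.  HONEST FRAMING (three columns): exact
real analysis about MODEL objects (ideal-MHD equilibrium inputs of a resistive-layer index; Solov'ev profiles,
analytic fixed boundary); `D_R < 0` is the printed resistive-interchange-stable range of the GGJ layer theory
(HamEtAl2013: «normally a small negative number» in tokamaks — a VALIDATED expectation, not asserted); no
enclosure and no stability claim here.  Typer/prover: gridfusion-model-5 (g4), 2026-08-27.
-/

noncomputable section

/-! ## §1 Generic: the printed Hamada-label pieces of volume-relabelled data -/

namespace Literature.MathematicalPhysics.MHD.Mercier.FluxForm.SurfaceData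

variable (d : SurfaceData)

/-- `H` of the volume-relabelled data in the original label:
`H = V′⟨B²/G⟩/Λ · (⟨σB²/G⟩/⟨B²/G⟩ − ⟨σB²⟩/⟨B²⟩)` (`V′, Λ, ⟨B²/G⟩ ≠ 0`; `⟨·/G⟩` averages scale by `1/V′²`,
`Λ` by `1/V′³`). [cite: Zheng2015, §2.3 eq. (2.64)] -/
theorem ggjH_relabel_volume (hV : d.V' ≠ 0) (hΛ : d.shear ≠ 0) (hg : d.gB2 ≠ 0) (sB2 B2 : ℝ) :
    (d.relabel d.V' d.V'').ggjH sB2 B2 = d.V' * d.gB2 / d.shear * (d.gσB2 / d.gB2 - sB2 / B2) := by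
  rw [ggjH, d.shear_relabel d.V' d.V'' hV]
  simp only [relabel]
  field_simp

/-- `F` (GGJ's, not Jardin's) of the volume-relabelled data in the original label:
`F = V′²⟨B²/G⟩/Λ² · (⟨σ²B²/G⟩ − ⟨σB²/G⟩²/⟨B²/G⟩ + p′²⟨1/B²⟩)`. [cite: Zheng2015, §2.3 eq. (2.64)] -/
theorem ggjF_relabel_volume (hV : d.V' ≠ 0) (hΛ : d.shear ≠ 0) (hg : d.gB2 ≠ 0) :
    (d.relabel d.V' d.V'').ggjF
      = d.V' ^ 2 * d.gB2 / d.shear ^ 2 * (d.gσ2B2 - d.gσB2 ^ 2 / d.gB2 + d.p' ^ 2 * d.invB2) := by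
  rw [ggjF, d.shear_relabel d.V' d.V'' hV]
  simp only [relabel]
  field_simp

/-- `E` of the volume-relabelled data in the original label, for FORCE-BALANCED data:
`E = V′⟨B²/G⟩/Λ² · (K′Φ″ − I′Ψ″ − p′V″ + Λ⟨σB²⟩/⟨B²⟩)` — the `V″`-terms of the relabelled `Φ″, Ψ″` combine
into `−V″(K′Φ′ − I′Ψ′) = −V″p′V′` by `p′V′ + I′Ψ′ − K′Φ′ = 0`. [cite: Zheng2015, §2.3 eq. (2.64)] -/
theorem ggjE_relabel_volume (hV : d.V' ≠ 0) (hΛ : d.shear ≠ 0) (hg : d.gB2 ≠ 0)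
    (hfb : d.IsForceBalanced) (sB2 B2 : ℝ) (hB : B2 ≠ 0) :
    (d.relabel d.V' d.V'').ggjE sB2 B2
      = d.V' * d.gB2 / d.shear ^ 2
          * (d.K' * d.Φ'' - d.I' * d.Ψ'' - d.p' * d.V'' + d.shear * (sB2 / B2)) := by
  unfold IsForceBalanced at hfb
  rw [ggjE, d.shear_relabel d.V' d.V'' hV]
  simp only [relabel]
  field_simp
  linear_combination (d.V'' * B2) * hfb

/-- The RESISTIVE-INTERCHANGE INDEX `D_R = F + E + H²` (Zheng (3.42)) of the volume-relabelled data in the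
original label (force-balanced data, `V′, Λ, ⟨B²/G⟩, ⟨B²⟩ ≠ 0`):
`D_R = [V′²⟨B²/G⟩(⟨σ²B²/G⟩ − ⟨σB²/G⟩²/⟨B²/G⟩ + p′²⟨1/B²⟩) + V′⟨B²/G⟩(K′Φ″ − I′Ψ″ − p′V″ + Λ⟨σB²⟩/⟨B²⟩)
       + V′²⟨B²/G⟩²(⟨σB²/G⟩/⟨B²/G⟩ − ⟨σB²⟩/⟨B²⟩)²] / Λ²`. [cite: Zheng2015, §3.2 eq. (3.42)] -/
theorem ggjDR_relabel_volume (hV : d.V' ≠ 0) (hΛ : d.shear ≠ 0) (hg : d.gB2 ≠ 0)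
    (hfb : d.IsForceBalanced) (sB2 B2 : ℝ) (hB : B2 ≠ 0) :
    (d.relabel d.V' d.V'').ggjDR sB2 B2
      = (d.V' ^ 2 * d.gB2 * (d.gσ2B2 - d.gσB2 ^ 2 / d.gB2 + d.p' ^ 2 * d.invB2)
          + d.V' * d.gB2 * (d.K' * d.Φ'' - d.I' * d.Ψ'' - d.p' * d.V'' + d.shear * (sB2 / B2))
          + d.V' ^ 2 * d.gB2 ^ 2 * (d.gσB2 / d.gB2 - sB2 / B2) ^ 2) / d.shear ^ 2 := by
  rw [ggjDR, d.ggjF_relabel_volume hV hΛ hg, d.ggjE_relabel_volume hV hΛ hg hfb sB2 B2 hB,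
    d.ggjH_relabel_volume hV hΛ hg]
  field_simp

/-- CONSISTENCY with the label-invariant Mercier index of `MercierFluxForm.lean` §5: for force-balanced data
the ideal index of the volume-relabelled data is `D_I = mercierD − 1/4` (`mercierD_eq_ggjDI_add` in the
Hamada label + `mercierD_relabel`). [cite: Zheng2015, §2.3 eq. (2.62)] -/
theorem ggjDI_relabel_volume_eq (hV : d.V' ≠ 0) (hΛ : d.shear ≠ 0) (hg : d.gB2 ≠ 0)
    (hfb : d.IsForceBalanced) (sB2 B2 : ℝ) :
    (d.relabel d.V' d.V'').ggjDI sB2 B2 = d.mercierD - 1 / 4 := by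
  obtain ⟨h1, h2⟩ := d.relabel_volume hV
  have hΛ' : (d.relabel d.V' d.V'').shear ≠ 0 := by
    rw [d.shear_relabel d.V' d.V'' hV]; exact div_ne_zero hΛ (pow_ne_zero 3 hV)
  have hg' : (d.relabel d.V' d.V'').gB2 ≠ 0 := by
    simp only [relabel]; exact div_ne_zero hg (pow_ne_zero 2 hV)
  have e := (d.relabel d.V' d.V'').mercierD_eq_ggjDI_add sB2 B2 h1 h2 hΛ' hg'
  rw [d.mercierD_relabel d.V' d.V'' hV hV hfb] at e
  linarith

/-- Hence also `D_R = mercierD − 1/4 + (H − 1/2)²` in any label (force-balanced data): the resistive index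
exceeds the label-invariant ideal index by a complete square. [cite: Zheng2015, §3.2 eq. (3.42)] -/
theorem ggjDR_relabel_volume_eq (hV : d.V' ≠ 0) (hΛ : d.shear ≠ 0) (hg : d.gB2 ≠ 0)
    (hfb : d.IsForceBalanced) (sB2 B2 : ℝ) :
    (d.relabel d.V' d.V'').ggjDR sB2 B2
      = d.mercierD - 1 / 4 + ((d.relabel d.V' d.V'').ggjH sB2 B2 - 1 / 2) ^ 2 := by
  rw [(d.relabel d.V' d.V'').ggjDR_eq_ggjDI_add_sq, d.ggjDI_relabel_volume_eq hV hΛ hg hfb]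

/-- A certified `D_R < 0` of the volume-relabelled data gives Jardin's Mercier criterion of the ORIGINAL data
(`mercierCriterion_of_ggjDR_neg` in the Hamada label, then label independence for force-balanced data).
[cite: Zheng2015, §3.2 eq. (3.42)] -/
theorem mercierCriterion_of_ggjDR_relabel_volume_neg (hV : d.V' ≠ 0) (hΛ : d.shear ≠ 0) (hg : d.gB2 ≠ 0)
    (hfb : d.IsForceBalanced) {sB2 B2 : ℝ} (h : (d.relabel d.V' d.V'').ggjDR sB2 B2 < 0) :
    d.MercierCriterion := by
  obtain ⟨h1, h2⟩ := d.relabel_volume hV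
  have hΛ' : (d.relabel d.V' d.V'').shear ≠ 0 := by
    rw [d.shear_relabel d.V' d.V'' hV]; exact div_ne_zero hΛ (pow_ne_zero 3 hV)
  have hg' : (d.relabel d.V' d.V'').gB2 ≠ 0 := by
    simp only [relabel]; exact div_ne_zero hg (pow_ne_zero 2 hV)
  exact (d.mercierCriterion_relabel_iff d.V' d.V'' hV hV hfb).mp
    ((d.relabel d.V' d.V'').mercierCriterion_of_ggjDR_neg sB2 B2 h1 h2 hΛ' hg' h)

end Literature.MathematicalPhysics.MHD.Mercier.FluxForm.SurfaceData

/-! ## §2 The two extra averages on the Lee–Cerfon / PCF family -/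

namespace Literature.MathematicalPhysics.MHD.Solovev

open GradShafranov FluxGeometry Mercier.FluxForm _root_.Real MeasureTheory intervalIntegral _root_.Set

section family

variable {R₀ κ FB q₀ r : ℝ} (hR₀ : 0 < R₀) (hκ : 0 < κ) (hFB : 0 < FB) (hq₀ : 0 < q₀)
  (hr : 0 < r) (h2r : 2 * r < R₀)
include hR₀ hκ hFB hq₀ hr h2r

/-- Continuity in `t` of `u`, `G = lcGradSq`, `w = lcAvgWeight` on a surface (`u, G > 0`). [folklore] -/
private theorem res_continuous_blocks :
    Continuous (fun t => lcU R₀ r t) ∧ Continuous (fun t => lcGradSq κ FB R₀ q₀ r t)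
      ∧ Continuous (fun t => lcAvgWeight κ FB R₀ q₀ r t) := by
  have hcU : Continuous (fun t => lcU R₀ r t) := by unfold lcU; fun_prop
  have hpos : ∀ t, 0 < lcU R₀ r t := lcU_pos hR₀ hr.le h2r
  refine ⟨hcU, ?_, continuous_lcAvgWeight hR₀ hκ hFB hq₀ hr.le h2r⟩
  rw [continuous_iff_continuousAt]
  intro t
  have hu := hpos t
  unfold lcGradSq
  fun_prop (disch := positivity)

omit hFB in
/-- `⟨σB²⟩ = C_s g` on every surface: `σB² = gΔ*Ψ/R² ≡ C_s g` is a surface constant (`sigmaBsq_lcLoop`) and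
`⟨const⟩ = const` on a regular surface. [cite: Jardin2010, §5.3 eq. (5.30)] -/
theorem surfaceAverageE_lcLoop_sigmaBsq (hFB : 0 < FB) (a g : ℝ) :
    surfaceAverageE (psiLC κ FB R₀ q₀ a) (lcLoop R₀ κ r) (2 * π)
        (fun R Z => g * gsOperator (psiLC κ FB R₀ q₀ a) R Z / R ^ 2)
      = csLC κ FB R₀ q₀ * g :=
  surfaceAverageE_of_const (volumeDerivE_lcLoop_pos hR₀ hκ hFB hq₀ hr h2r a).ne'
    fun t _ => sigmaBsq_lcLoop hR₀ hκ hq₀ hr h2r a g t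

/-- `⟨B²⟩ = ∫ (g² + G)/u · w dt ÷ ∫ w dt` on the loop (`B² = (g² + G)/u`, constant `F ≡ g`).
[cite: Jardin2010, §5.3 eq. (5.30)] -/
theorem surfaceAverageE_lcLoop_bsq (g a : ℝ) :
    surfaceAverageE (psiLC κ FB R₀ q₀ a) (lcLoop R₀ κ r) (2 * π)
        (fun R Z => fieldBsq (fun _ => g) (psiLC κ FB R₀ q₀ a) R Z)
      = (∫ t in (0 : ℝ)..(2 * π), (g ^ 2 + lcGradSq κ FB R₀ q₀ r t) / lcU R₀ r t
            * lcAvgWeight κ FB R₀ q₀ r t)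
          / ∫ t in (0 : ℝ)..(2 * π), lcAvgWeight κ FB R₀ q₀ r t := by
  rw [surfaceAverageE_lcLoop hR₀ hκ hFB hq₀ hr h2r a]
  congr 1
  exact intervalIntegral.integral_congr fun t _ => by
    rw [fieldBsq_lcLoop hR₀ hκ.ne' hr.le h2r]

/-- **`⟨B²⟩` is affine in `g²`:** `⟨B²⟩ = g²·(∫w/u ÷ ∫w) + ∫ G·w/u ÷ ∫w` — the first integral is the
`⟨R⁻²⟩` block already in `Φ′`, the second (`= ∫ B_p²·w`, i.e. `V′⟨B_p²⟩/(2π)`) is the ONE new integral the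
resistive index needs. [cite: Jardin2010, §5.3 eq. (5.30)] -/
theorem surfaceAverageE_lcLoop_bsq_split (g a : ℝ) :
    surfaceAverageE (psiLC κ FB R₀ q₀ a) (lcLoop R₀ κ r) (2 * π)
        (fun R Z => fieldBsq (fun _ => g) (psiLC κ FB R₀ q₀ a) R Z)
      = g ^ 2 * ((∫ t in (0 : ℝ)..(2 * π), lcAvgWeight κ FB R₀ q₀ r t / lcU R₀ r t)
          / ∫ t in (0 : ℝ)..(2 * π), lcAvgWeight κ FB R₀ q₀ r t)
        + (∫ t in (0 : ℝ)..(2 * π), lcGradSq κ FB R₀ q₀ r t * lcAvgWeight κ FB R₀ q₀ r t / lcU R₀ r t)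
          / ∫ t in (0 : ℝ)..(2 * π), lcAvgWeight κ FB R₀ q₀ r t := by
  obtain ⟨hcU, hcG, hcW⟩ := res_continuous_blocks hR₀ hκ hFB hq₀ hr h2r
  have hposU : ∀ t, 0 < lcU R₀ r t := lcU_pos hR₀ hr.le h2r
  rw [surfaceAverageE_lcLoop_bsq hR₀ hκ hFB hq₀ hr h2r g a]
  have h1 : Continuous fun t => lcAvgWeight κ FB R₀ q₀ r t / lcU R₀ r t :=
    hcW.div hcU fun t => (hposU t).ne'
  have h2 : Continuous fun t => lcGradSq κ FB R₀ q₀ r t * lcAvgWeight κ FB R₀ q₀ r t / lcU R₀ r t :=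
    (hcG.mul hcW).div hcU fun t => (hposU t).ne'
  have hsplit : ∫ t in (0 : ℝ)..(2 * π), (g ^ 2 + lcGradSq κ FB R₀ q₀ r t) / lcU R₀ r t
        * lcAvgWeight κ FB R₀ q₀ r t
      = g ^ 2 * (∫ t in (0 : ℝ)..(2 * π), lcAvgWeight κ FB R₀ q₀ r t / lcU R₀ r t)
        + ∫ t in (0 : ℝ)..(2 * π),
            lcGradSq κ FB R₀ q₀ r t * lcAvgWeight κ FB R₀ q₀ r t / lcU R₀ r t := by
    rw [← intervalIntegral.integral_const_mul, ← intervalIntegral.integral_add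
      ((h1.const_mul _).intervalIntegrable _ _) (h2.intervalIntegrable _ _)]
    refine intervalIntegral.integral_congr fun t _ => ?_
    rw [div_mul_eq_mul_div, add_mul, add_div, mul_div_assoc]
  rw [hsplit, add_div, mul_div_assoc]

/-- The new integral is positive: `∫₀^{2π} G·w/u dt > 0`. [cite: Jardin2010, §5.3 eq. (5.30)] -/
theorem integral_gradSq_weight_div_u_pos :
    0 < ∫ t in (0 : ℝ)..(2 * π),
        lcGradSq κ FB R₀ q₀ r t * lcAvgWeight κ FB R₀ q₀ r t / lcU R₀ r t := by
  obtain ⟨hcU, hcG, hcW⟩ := res_continuous_blocks hR₀ hκ hFB hq₀ hr h2r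
  have hposU : ∀ t, 0 < lcU R₀ r t := lcU_pos hR₀ hr.le h2r
  have hposG : ∀ t, 0 < lcGradSq κ FB R₀ q₀ r t := lcGradSq_pos hR₀ hκ hFB hq₀ hr h2r
  have hposW : ∀ t, 0 < lcAvgWeight κ FB R₀ q₀ r t := lcAvgWeight_pos hR₀ hκ hFB hq₀ hr.le h2r
  exact intervalIntegral_pos_of_pos_on
    (((hcG.mul hcW).div hcU fun t => (hposU t).ne').intervalIntegrable _ _)
    (fun t _ => div_pos (mul_pos (hposG t) (hposW t)) (hposU t)) (by positivity)

/-- `⟨B²⟩ > 0` on every surface, for every value of the free constant. [cite: Jardin2010, §5.3 eq. (5.30)] -/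
theorem surfaceAverageE_lcLoop_bsq_pos (g a : ℝ) :
    0 < surfaceAverageE (psiLC κ FB R₀ q₀ a) (lcLoop R₀ κ r) (2 * π)
        (fun R Z => fieldBsq (fun _ => g) (psiLC κ FB R₀ q₀ a) R Z) := by
  rw [surfaceAverageE_lcLoop_bsq_split hR₀ hκ hFB hq₀ hr h2r g a]
  have hW := integral_lcAvgWeight_pos hR₀ hκ hFB hq₀ hr.le h2r
  obtain ⟨-, -, h3, -, -⟩ := integral_ggjBlocks_pos hR₀ hκ hFB hq₀ hr h2r g
  have h4 := integral_gradSq_weight_div_u_pos hR₀ hκ hFB hq₀ hr h2r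
  positivity

/-- `⟨B²/|∇Ψ|²⟩ > 0` on every surface (`lcGGJData.gB2 ≠ 0`, the hypothesis of the GGJ algebra).
[cite: Jardin2010, §8.5.4 eq. (8.134)] -/
theorem lcGGJData_gB2_pos (a g : ℝ) : 0 < (lcGGJData κ FB R₀ q₀ a g r).gB2 := by
  rw [lcGGJData_gB2 hR₀ hκ hFB hq₀ hr h2r,
    ← surfaceAverageE_lcLoop_bsqDivGradSq hR₀ hκ hFB hq₀ hr h2r g a,
    surfaceAverageE_lcLoop_bsqDivGradSq_split hR₀ hκ hFB hq₀ hr h2r g a]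
  have hW := integral_lcAvgWeight_pos hR₀ hκ hFB hq₀ hr.le h2r
  obtain ⟨-, h2, h3, -, -⟩ := integral_ggjBlocks_pos hR₀ hκ hFB hq₀ hr h2r g
  positivity

end family

/-! ## §3 The resistive-interchange index of a surface of the family -/

/-- THE RESISTIVE-INTERCHANGE INDEX `D_R` (Glasser–Greene–Johnson; Zheng (3.42)) OF THE SURFACE of minor-radius
label `r` of `Ψ = psiLC κ F_B R₀ q₀ a`, free constant `F ≡ g`: lit-3's printed Hamada-label `ggjDR` of the
VOLUME-RELABELLED GGJ record `lcGGJData` (Hamada by `relabel_volume`), fed with the two label-independent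
averages `⟨σB²⟩ = ⟨gΔ*Ψ/R²⟩` and `⟨B²⟩ = ⟨fieldBsq (F ≡ g)⟩` of the same surface.  MODELLED: ideal-MHD
equilibrium inputs of the resistive singular-layer index (GGJ 1975 via Zheng 2015 §3.2); Solov'ev profiles,
analytic fixed boundary. [cite: Zheng2015, §3.2 eq. (3.42)] -/
def lcResistiveIndex (κ FB R₀ q₀ a g r : ℝ) : ℝ :=
  ((lcGGJData κ FB R₀ q₀ a g r).relabel (lcGGJData κ FB R₀ q₀ a g r).V'
      (lcGGJData κ FB R₀ q₀ a g r).V'').ggjDR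
    (surfaceAverageE (psiLC κ FB R₀ q₀ a) (lcLoop R₀ κ r) (2 * π)
      (fun R Z => g * gsOperator (psiLC κ FB R₀ q₀ a) R Z / R ^ 2))
    (surfaceAverageE (psiLC κ FB R₀ q₀ a) (lcLoop R₀ κ r) (2 * π)
      (fun R Z => fieldBsq (fun _ => g) (psiLC κ FB R₀ q₀ a) R Z))

section index

variable {R₀ κ FB q₀ r : ℝ} (hR₀ : 0 < R₀) (hκ : 0 < κ) (hFB : 0 < FB) (hq₀ : 0 < q₀)
  (hr : 0 < r) (h2r : 2 * r < R₀)
include hR₀ hκ hFB hq₀ hr h2r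

omit hR₀ hκ hFB hq₀ hr h2r in
/-- The shear combination of the record is `Λ = −2πΦ″` (`Ψ′ = 2π`, `Ψ″ = 0`). [cite: Jardin2010, §8.5.4 eq. (8.134)] -/
theorem lcGGJData_shear (a g : ℝ) :
    (lcGGJData κ FB R₀ q₀ a g r).shear = -(2 * π * (lcGGJData κ FB R₀ q₀ a g r).Φ'') := by
  simp only [SurfaceData.shear, lcGGJData]
  ring

/-- **`D_R` of the surface in closed form** through the record's fields (each an explicit one-dimensional
integral by `lcGGJData_V'/V''/Φ''/gB2/gσB2/gσ2B2/invB2`) and `⟨B²⟩` (`surfaceAverageE_lcLoop_bsq_split`):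
with `K′ = 0`, `Ψ″ = 0`, `p′ = −C_s`, `⟨σB²⟩ = C_s g`, `Λ = −2πΦ″`,
`D_R = [V′²⟨B²/G⟩(⟨σ²B²/G⟩ − ⟨σB²/G⟩²/⟨B²/G⟩ + C_s²⟨1/B²⟩) + V′⟨B²/G⟩(C_sV″ − 2πΦ″·C_s g/⟨B²⟩)
       + V′²⟨B²/G⟩²(⟨σB²/G⟩/⟨B²/G⟩ − C_s g/⟨B²⟩)²] / (2πΦ″)²`, on every surface with shear (`Φ″ ≠ 0`).
[cite: Zheng2015, §3.2 eq. (3.42)] -/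
theorem lcResistiveIndex_eq (a g : ℝ) (hΦ : (lcGGJData κ FB R₀ q₀ a g r).Φ'' ≠ 0) :
    lcResistiveIndex κ FB R₀ q₀ a g r
      = ((lcGGJData κ FB R₀ q₀ a g r).V' ^ 2 * (lcGGJData κ FB R₀ q₀ a g r).gB2
            * ((lcGGJData κ FB R₀ q₀ a g r).gσ2B2
              - (lcGGJData κ FB R₀ q₀ a g r).gσB2 ^ 2 / (lcGGJData κ FB R₀ q₀ a g r).gB2
              + csLC κ FB R₀ q₀ ^ 2 * (lcGGJData κ FB R₀ q₀ a g r).invB2)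
          + (lcGGJData κ FB R₀ q₀ a g r).V' * (lcGGJData κ FB R₀ q₀ a g r).gB2
            * (csLC κ FB R₀ q₀ * (lcGGJData κ FB R₀ q₀ a g r).V''
              - 2 * π * (lcGGJData κ FB R₀ q₀ a g r).Φ''
                * (csLC κ FB R₀ q₀ * g / surfaceAverageE (psiLC κ FB R₀ q₀ a) (lcLoop R₀ κ r) (2 * π)
                    (fun R Z => fieldBsq (fun _ => g) (psiLC κ FB R₀ q₀ a) R Z)))
          + (lcGGJData κ FB R₀ q₀ a g r).V' ^ 2 * (lcGGJData κ FB R₀ q₀ a g r).gB2 ^ 2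
            * ((lcGGJData κ FB R₀ q₀ a g r).gσB2 / (lcGGJData κ FB R₀ q₀ a g r).gB2
              - csLC κ FB R₀ q₀ * g / surfaceAverageE (psiLC κ FB R₀ q₀ a) (lcLoop R₀ κ r) (2 * π)
                    (fun R Z => fieldBsq (fun _ => g) (psiLC κ FB R₀ q₀ a) R Z)) ^ 2)
        / (2 * π * (lcGGJData κ FB R₀ q₀ a g r).Φ'') ^ 2 := by
  have hV := lcGGJData_V'_ne hR₀ hκ hFB hq₀ hr h2r (a := a) (g := g)
  have hΛ : (lcGGJData κ FB R₀ q₀ a g r).shear ≠ 0 := by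
    rw [lcGGJData_shear]
    exact neg_ne_zero.mpr (mul_ne_zero (mul_ne_zero two_ne_zero Real.pi_ne_zero) hΦ)
  have hg := (lcGGJData_gB2_pos hR₀ hκ hFB hq₀ hr h2r a g).ne'
  have hB := (surfaceAverageE_lcLoop_bsq_pos hR₀ hκ hFB hq₀ hr h2r g a).ne'
  have hfb := lcGGJData_isForceBalanced hR₀ hκ hFB hq₀ hr h2r a g
  unfold lcResistiveIndex
  rw [SurfaceData.ggjDR_relabel_volume _ hV hΛ hg hfb _ _ hB,
    surfaceAverageE_lcLoop_sigmaBsq hR₀ hκ hq₀ hr h2r hFB, lcGGJData_shear]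
  have hK : (lcGGJData κ FB R₀ q₀ a g r).K' = 0 := rfl
  have hΨ2 : (lcGGJData κ FB R₀ q₀ a g r).Ψ'' = 0 := rfl
  have hp : (lcGGJData κ FB R₀ q₀ a g r).p' = -csLC κ FB R₀ q₀ := rfl
  rw [hK, hΨ2, hp]
  congr 1
  · ring
  · ring

/-- **Kernel consequence of a certified sign.**  If `D_R < 0` on a surface with shear (`Φ″ ≠ 0`), Jardin's
Mercier criterion (8.134) holds there: lit-3's `mercierCriterion_of_ggjDR_neg` in the Hamada label, carried back
by label independence, whose force-balance hypothesis is discharged on the family (`lcGGJData_isForceBalanced`).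
(`D_I ≤ D_R` always; the converse fails by `(H − 1/2)²`.) [cite: Zheng2015, §3.2 eq. (3.42)] -/
theorem mercierCriterion_of_lcResistiveIndex_neg (a g : ℝ) (hΦ : (lcGGJData κ FB R₀ q₀ a g r).Φ'' ≠ 0)
    (h : lcResistiveIndex κ FB R₀ q₀ a g r < 0) : (lcGGJData κ FB R₀ q₀ a g r).MercierCriterion := by
  have hV := lcGGJData_V'_ne hR₀ hκ hFB hq₀ hr h2r (a := a) (g := g)
  have hΛ : (lcGGJData κ FB R₀ q₀ a g r).shear ≠ 0 := by
    rw [lcGGJData_shear]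
    exact neg_ne_zero.mpr (mul_ne_zero (mul_ne_zero two_ne_zero Real.pi_ne_zero) hΦ)
  have hg := (lcGGJData_gB2_pos hR₀ hκ hFB hq₀ hr h2r a g).ne'
  exact SurfaceData.mercierCriterion_of_ggjDR_relabel_volume_neg _ hV hΛ hg
    (lcGGJData_isForceBalanced hR₀ hκ hFB hq₀ hr h2r a g) h

/-- The same index as lit-3's label-invariant `mercierD` plus a complete square:
`D_R = mercierD − 1/4 + (H − 1/2)²`, `H = V′⟨B²/G⟩/Λ·(⟨σB²/G⟩/⟨B²/G⟩ − C_s g/⟨B²⟩)`.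
[cite: Zheng2015, §3.2 eq. (3.42)] -/
theorem lcResistiveIndex_eq_mercierD (a g : ℝ) (hΦ : (lcGGJData κ FB R₀ q₀ a g r).Φ'' ≠ 0) :
    lcResistiveIndex κ FB R₀ q₀ a g r
      = (lcGGJData κ FB R₀ q₀ a g r).mercierD - 1 / 4
        + ((lcGGJData κ FB R₀ q₀ a g r).V' * (lcGGJData κ FB R₀ q₀ a g r).gB2
            / (lcGGJData κ FB R₀ q₀ a g r).shear
            * ((lcGGJData κ FB R₀ q₀ a g r).gσB2 / (lcGGJData κ FB R₀ q₀ a g r).gB2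
              - csLC κ FB R₀ q₀ * g / surfaceAverageE (psiLC κ FB R₀ q₀ a) (lcLoop R₀ κ r) (2 * π)
                  (fun R Z => fieldBsq (fun _ => g) (psiLC κ FB R₀ q₀ a) R Z)) - 1 / 2) ^ 2 := by
  have hV := lcGGJData_V'_ne hR₀ hκ hFB hq₀ hr h2r (a := a) (g := g)
  have hΛ : (lcGGJData κ FB R₀ q₀ a g r).shear ≠ 0 := by
    rw [lcGGJData_shear]
    exact neg_ne_zero.mpr (mul_ne_zero (mul_ne_zero two_ne_zero Real.pi_ne_zero) hΦ)
  have hg := (lcGGJData_gB2_pos hR₀ hκ hFB hq₀ hr h2r a g).ne'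
  have hfb := lcGGJData_isForceBalanced hR₀ hκ hFB hq₀ hr h2r a g
  unfold lcResistiveIndex
  rw [SurfaceData.ggjDR_relabel_volume_eq _ hV hΛ hg hfb, SurfaceData.ggjH_relabel_volume _ hV hΛ hg,
    surfaceAverageE_lcLoop_sigmaBsq hR₀ hκ hq₀ hr h2r hFB]

end index

end Literature.MathematicalPhysics.MHD.Solovev
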